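import Summits.BirchSwinnertonDyer.Rank1Residual.X11b.AnticyclotomicControlNPlus
import Summits.BirchSwinnertonDyer.Rank1Residual.X11b.BDPRouteControlSnake
import HarnessLib

/-!
# X11b, route R1 — the `Σ(N⁺) → ∅` PASSAGE of the anticyclotomic control theorem, EXACT form on the
# constructed objects: `#Sel_𝔭(K_∞, E[p^∞])^Γ = #Sel_𝔭(K, E[p^∞]) · #(loc_Σ(Sel_𝔭^Σ(K, E[p^∞])) ∩ ∏_{w∈Σ} ker r_w)`

HONEST FRAMING (cell `b2b-bsdres`, run/shared/lean/b2b/bsd-rank1-residual/, verbatim in every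
file): the goal of the cell is to DELETE the COMBINATION-SHAPED residual classes of the
Birch–Swinnerton-Dyer formula for ALL analytic-rank `≤ 1` elliptic curves over `ℚ` — "full BSD
formula for every rank `≤ 1` curve in class `C`" assembled STRICTLY from published theorems — so
that the rank-`≤ 1` remainder becomes exactly the CONSTRUCTION-SHAPED classes, which are TYPED
(missing-input `Prop`s), NOT attempted. This is not "finishing BSD". Sub-cell
`b2b-bsdres-multr1-p1` (X11b, route R1 = Castella 2018 Thm. A re-proved along the author's
erratum); a RESEARCH ROUTE; no claim beyond the stated class; X11b stays CONSTRUCTION-SHAPED;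
nothing here changes a label; no named fact is minted (two definitions with bodies — a
localisation map and a product subgroup — and theorems; no `sorry`).

## Why this file (JSW17 §3.3.4, second display; Greenberg LNM 1716 §3)

The typed control input of route R1, `ControlOnTreeAt` (Cas18 Thm. 2.3 ⇐ JSW17 Thm. 3.3.1), is a
statement about the `Σ = ∅` module `X_ac(E[p^∞])`, whose Tamagawa term runs over `w ∣ N⁺`. After
gen 11 the control map `s^Σ : Sel_𝔭^Σ(K, E[p^∞]) → Sel_𝔭^Σ(K_∞, E[p^∞])^Γ` is a kernel-proved
BIJECTION for `Σ = Σ(N⁺)` (`ChainLocus.controlMap_bijective_nPlus`), with NO residual input; for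
`Σ = ∅` it is injective but NOT surjective (local kernels of order `c_w^{(p)}` at the `w ∣ N⁺`). This
file proves the passage `Σ → ∅` in exact form, for ANY finite `Σ` away from `p` at which `s^Σ` is
bijective:

`Sel_𝔭(K) = {c ∈ Sel_𝔭^Σ(K) : loc_w c = 0, w ∈ Σ}` (`mem_selmerAcBase_empty_iff_of_subset`); for
`c ∈ Sel_𝔭^Σ(K)`, `res c ∈ Sel_𝔭(K_∞)` iff `loc_w c ∈ ker r_w` for `w ∈ Σ`, `r_w : H¹(K_w, E[p^∞]) →
H¹(K_{∞,η}, E[p^∞])` the sibling's `AcSelmer.localKer` (`resOfLe_mem_selmerAc_empty_iff`; a restricted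
class is `Γ_K`-invariant, so ONE place above `w` suffices); hence, `s^Σ` being bijective,
**`#Sel_𝔭(K_∞, E[p^∞])^γ = #Sel_𝔭(K, E[p^∞]) · #(im loc_Σ ∩ ∏_{w∈Σ} ker r_w)`**
(`natCard_endInvariants_empty_eq`, all `Nat.card`, no finiteness assumed: `(s^Σ)⁻¹` identifies
`Sel_𝔭(K_∞)^γ` with `loc_Σ⁻¹(∏ ker r_w) ⊆ Sel_𝔭^Σ(K)`, and `#f⁻¹(B) = #ker f · #(im f ∩ B)`), and, if
`∏ ker r_w ⊆ im loc_Σ` (e.g. `loc_Σ` onto, JSW17 Prop. 3.3.2 — NOT proved here: Poitou–Tate),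
**`#Sel_𝔭(K_∞, E[p^∞])^γ = #Sel_𝔭(K, E[p^∞]) · ∏_{w∈Σ} #ker r_w`** (`…_mul_prod`) — JSW17 §3.3.4's
"`#coker(s)/#ker(s) = #ker(r)/#ker(h)`" with `ker s = ker h = 0`. Route R1 (`Σ = Σ(N⁺)`) and the typed
atoms separating this from Cas18 Thm. 2.3: `AnticyclotomicControlAtoms.lean`.

References: [JetchevSkinnerWan2017] Camb. J. Math. 5 (2017) §3.3.4 (arXiv:1512.06894 pp. 13–14); [GreenbergLNM1716] §3 pp. 85–90; [Castella2018] Thm. 2.3.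
-/

noncomputable section

open scoped Classical

open NumberField IsDedekindDomain Field
open Literature.NumberTheory.EllipticCurves Literature.NumberTheory.EllipticCurves.GreenbergSelmer
open Literature.NumberTheory.GaloisRepresentations

namespace Summit.BirchSwinnertonDyer.Rank1Residual.X11b.AcSelmer

section Group

variable {G H : Type*} [AddCommGroup G] [AddCommGroup H]

/-- **`#f⁻¹(B) = #ker f · #(im f ∩ B)`** for a homomorphism `f : G → H` of abelian groups and a
subgroup `B ≤ H` (`Nat.card`; the restriction `f⁻¹(B) → im f ∩ B` is onto with kernel `ker f`).
[folklore] -/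
theorem natCard_comap_eq_natCard_ker_mul (f : G →+ H) (B : AddSubgroup H) :
    Nat.card (B.comap f) = Nat.card f.ker * Nat.card ↥(f.range ⊓ B) := by
  set f' : B.comap f →+ ↥(f.range ⊓ B) :=
    { toFun := fun x ↦ ⟨f x, AddSubgroup.mem_inf.mpr ⟨⟨x, rfl⟩, AddSubgroup.mem_comap.mp x.2⟩⟩
      map_zero' := Subtype.ext (by simp)
      map_add' := fun a b ↦ Subtype.ext (by simp) } with hf'
  have hsurj : Function.Surjective f' := by
    rintro ⟨y, hyr, hyB⟩
    obtain ⟨x, rfl⟩ := hyr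
    exact ⟨⟨x, AddSubgroup.mem_comap.mpr hyB⟩, rfl⟩
  have e : f'.ker ≃ f.ker :=
    { toFun := fun x ↦ ⟨((x : B.comap f) : G), by
        have hx : f' x = 0 := x.2
        exact (AddMonoidHom.mem_ker).mpr (congrArg Subtype.val hx)⟩
      invFun := fun y ↦ ⟨⟨(y : G), AddSubgroup.mem_comap.mpr (by
          rw [(AddMonoidHom.mem_ker).mp y.2]; exact zero_mem B)⟩,
        (AddMonoidHom.mem_ker).mpr (Subtype.ext ((AddMonoidHom.mem_ker).mp y.2))⟩
      left_inv := fun x ↦ Subtype.ext (Subtype.ext rfl)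
      right_inv := fun y ↦ Subtype.ext rfl }
  rw [AddSubgroup.card_eq_card_quotient_mul_card_addSubgroup f'.ker,
    Nat.card_congr (QuotientAddGroup.quotientKerEquivOfSurjective f' hsurj).toEquiv,
    Nat.card_congr e, mul_comm]

/-- `Nat.card` of a product subgroup `∏_i H_i ≤ ∏_i G_i` over a finite index type is the product of
the `Nat.card (H_i)`. [folklore] -/
theorem natCard_pi_univ {ι : Type*} [Fintype ι] {A : ι → Type*} [∀ i, AddCommGroup (A i)]
    (Hs : ∀ i, AddSubgroup (A i)) :
    Nat.card (AddSubgroup.pi Set.univ Hs) = ∏ i, Nat.card (Hs i) := by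
  have e : (AddSubgroup.pi Set.univ Hs) ≃ (Π i, Hs i) :=
    { toFun := fun x i ↦ ⟨(x : Π i, A i) i, (AddSubgroup.mem_pi _).mp x.2 i (Set.mem_univ i)⟩
      invFun := fun y ↦ ⟨fun i ↦ (y i : A i), (AddSubgroup.mem_pi _).mpr fun i _ ↦ (y i).2⟩
      left_inv := fun x ↦ Subtype.ext rfl
      right_inv := fun y ↦ rfl }
  rw [Nat.card_congr e, Nat.card_pi]

end Group

/-! ## `Sel_𝔭(K) ⊆ Sel_𝔭^Σ(K)` and `res⁻¹(Sel_𝔭(K_∞))` in terms of localisations at `Σ` -/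

section Membership

variable {K : Type} [Field K] [NumberField K]
variable {E : WeierstrassCurve K} {p : ℕ} [Fact p.Prime] {κ : ZpExtension K p}
  {𝔭 : HeightOneSpectrum (𝓞 K)} {S : Set (HeightOneSpectrum (𝓞 K))}

omit [Fact p.Prime] in
/-- **`Sel_𝔭(K, E[p^∞]) = {c ∈ Sel_𝔭^Σ(K, E[p^∞]) : loc_w c = 0, w ∈ Σ}`** for `Σ` away from `p`: over
`K` the conjugates `conj_σ c` are `c` itself (`σ ∈ Γ_K = ⊤`), so Castella's away condition at `w`
is the vanishing of the single localisation `res_{D_w} c`. [cite: Castella2018, Def. 2.2 (arXiv:1704.06608 p. 5)] -/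
theorem mem_selmerAcBase_empty_iff_of_subset (hSp : ∀ v ∈ S, ((p : ℕ) : 𝓞 K) ∉ v.asIdeal)
    (c : E.subgroupH1 p (⊤ : Subgroup (absoluteGaloisGroup K))) :
    c ∈ selmerAcBase E p 𝔭 ∅ ↔ c ∈ selmerAcBase E p 𝔭 S ∧
      ∀ v ∈ S, resOfLe (E.geomPrimaryTorsion p)
        (inf_le_left : (⊤ : Subgroup (absoluteGaloisGroup K)) ⊓ decomp v ≤ ⊤) c = 0 := by
  constructor
  · intro hc
    refine ⟨selmerOver_mono (Set.empty_subset S) hc, fun v hv ↦ ?_⟩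
    exact (mem_awayKer_top_iff v c).mp
      (mem_awayKer_of_mem_selmerAcBase hc (hSp v hv) (Set.notMem_empty v))
  · rintro ⟨hc, hloc⟩
    have hc' := (mem_selmerOver_iff _).mp hc
    refine (mem_selmerOver_iff _).mpr ⟨fun v hv _ σ ↦ ?_, hc'.2.1, hc'.2.2⟩
    by_cases hvS : v ∈ S
    · rw [conjH1_of_mem_holds ⊤ (E.geomPrimaryTorsion p) (Subgroup.mem_top σ),
        AddMonoidHom.id_apply]
      exact (mem_awayKer_top_iff v c).mpr (hloc v hvS)
    · exact hc'.1 v hv hvS σ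

/-- **For `c ∈ Sel_𝔭^Σ(K, E[p^∞])`: `res_{K→K_∞} c ∈ Sel_𝔭(K_∞, E[p^∞])` iff `loc_w c ∈ ker r_w` for
every `w ∈ Σ`** (`Σ` away from `p`): the restricted class lies in `Sel_𝔭^Σ(K_∞)` and is
`Γ_K`-invariant (`conjH1_resOfLe_top`), so the missing away conditions above `w ∈ Σ` reduce to
`res c ∈ awayKer (ker κ) w`, i.e. to `loc_w c ∈ ker r_w` (`resOfLe_mem_localKer_iff`).
[cite: GreenbergLNM1716, §3 p. 90 ("`ker g_n ⊆ ⊕ ker r_v`")] [cite: JetchevSkinnerWan2017, §3.3.4 (arXiv:1512.06894 p. 13) (the map `r`)] -/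
theorem resOfLe_mem_selmerAc_empty_iff (hSp : ∀ v ∈ S, ((p : ℕ) : 𝓞 K) ∉ v.asIdeal)
    {c : E.subgroupH1 p (⊤ : Subgroup (absoluteGaloisGroup K))} (hc : c ∈ selmerAcBase E p 𝔭 S) :
    E.resOfLe p (le_top : κ.kerSubgroup ≤ ⊤) c ∈ selmerAc E p κ 𝔭 ∅ ↔
      ∀ v ∈ S, resOfLe (E.geomPrimaryTorsion p)
        (inf_le_left : (⊤ : Subgroup (absoluteGaloisGroup K)) ⊓ decomp v ≤ ⊤) c ∈
          localKer κ.kerSubgroup (E.geomPrimaryTorsion p) v := by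
  constructor
  · intro h v hv
    rw [resOfLe_mem_localKer_iff]
    have h1 := ((mem_selmerOver_iff _).mp h).1 v (hSp v hv) (Set.notMem_empty v) 1
    rwa [conjH1_one_holds, AddMonoidHom.id_apply] at h1
  · intro h
    have hT := (mem_selmerOver_iff _).mp (resOfLe_mem_selmerAc (κ := κ) hc)
    refine (mem_selmerOver_iff _).mpr ⟨fun v hv _ σ ↦ ?_, hT.2.1, hT.2.2⟩
    by_cases hvS : v ∈ S
    · rw [conjH1_resOfLe_top σ c]
      exact (resOfLe_mem_localKer_iff v c).mp (h v hvS)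
    · exact hT.1 v hv hvS σ

end Membership

/-! ## The localisation `loc_Σ` on `Sel_𝔭^Σ(K, E[p^∞])` and the subgroup `∏_{w∈Σ} ker r_w` -/

section Loc

variable {K : Type} [Field K] [NumberField K]
variable (E : WeierstrassCurve K) (p : ℕ) [Fact p.Prime] (κ : ZpExtension K p)
  (𝔭 : HeightOneSpectrum (𝓞 K)) {S : Set (HeightOneSpectrum (𝓞 K))} (hS : S.Finite)

/-- **`loc_Σ : Sel_𝔭^Σ(K, E[p^∞]) → ∏_{w∈Σ} H¹(K_w, E[p^∞])`**, `c ↦ (res_{D_w} c)_{w∈Σ}`, for a finite `Σ`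
(the sibling's `locAtFinset` restricted to Castella's Selmer group over `K`).
[cite: JetchevSkinnerWan2017, §3.3.1 (arXiv:1512.06894 p. 11), the maps (restrict-eq2)] -/
def locSel : selmerAcBase E p 𝔭 S →+
    Π v : hS.toFinset, subgroupH1 ((⊤ : Subgroup (absoluteGaloisGroup K)) ⊓
      decomp (v : HeightOneSpectrum (𝓞 K))) (E.geomPrimaryTorsion p) :=
  (locAtFinset E p hS.toFinset).comp (selmerAcBase E p 𝔭 S).subtype

/-- **`∏_{w∈Σ} ker r_w ≤ ∏_{w∈Σ} H¹(K_w, E[p^∞])`**, the product of Greenberg's local kernels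
`ker (H¹(K_w, E[p^∞]) → H¹(K_{∞,η}, E[p^∞]))` over `Σ`.
[cite: GreenbergLNM1716, §3 p. 85 (`⊕ ker r_v`)] [cite: JetchevSkinnerWan2017, §3.3.3 (arXiv:1512.06894 p. 12), `ker(r)`] -/
def localKerPi : AddSubgroup (Π v : hS.toFinset, subgroupH1 ((⊤ : Subgroup (absoluteGaloisGroup K)) ⊓
    decomp (v : HeightOneSpectrum (𝓞 K))) (E.geomPrimaryTorsion p)) :=
  AddSubgroup.pi Set.univ fun v ↦
    localKer κ.kerSubgroup (E.geomPrimaryTorsion p) (v : HeightOneSpectrum (𝓞 K))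

variable {E p κ 𝔭 hS}

omit [Fact p.Prime] in
/-- Unfolding `locSel`. [folklore] -/
@[simp]
theorem locSel_apply (c : selmerAcBase E p 𝔭 S) (v : hS.toFinset) :
    locSel E p 𝔭 hS c v =
      resOfLe (E.geomPrimaryTorsion p)
        (inf_le_left : (⊤ : Subgroup (absoluteGaloisGroup K)) ⊓
          decomp (v : HeightOneSpectrum (𝓞 K)) ≤ ⊤) (c : E.subgroupH1 p ⊤) :=
  rfl

/-- Membership in `∏_{w∈Σ} ker r_w`. [folklore] -/
theorem mem_localKerPi_iff
    (x : Π v : hS.toFinset, subgroupH1 ((⊤ : Subgroup (absoluteGaloisGroup K)) ⊓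
      decomp (v : HeightOneSpectrum (𝓞 K))) (E.geomPrimaryTorsion p)) :
    x ∈ localKerPi E p κ hS ↔
      ∀ v : hS.toFinset, x v ∈ localKer κ.kerSubgroup (E.geomPrimaryTorsion p)
        (v : HeightOneSpectrum (𝓞 K)) := by
  rw [localKerPi, AddSubgroup.mem_pi]
  exact ⟨fun h v ↦ h v (Set.mem_univ v), fun h v _ ↦ h v⟩

/-- `#(∏_{w∈Σ} ker r_w) = ∏_{w∈Σ} #ker r_w`. [folklore] -/
theorem natCard_localKerPi :
    Nat.card (localKerPi E p κ hS) =
      ∏ v ∈ hS.toFinset, Nat.card (localKer κ.kerSubgroup (E.geomPrimaryTorsion p) v) := by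
  rw [localKerPi, natCard_pi_univ, Finset.prod_coe_sort hS.toFinset
    (fun v ↦ Nat.card (localKer κ.kerSubgroup (E.geomPrimaryTorsion p) v))]

omit [Fact p.Prime] in
/-- **`ker (loc_Σ|Sel^Σ) = Sel_𝔭(K, E[p^∞])`** inside `Sel_𝔭^Σ(K, E[p^∞])`
(`mem_selmerAcBase_empty_iff_of_subset`). [cite: JetchevSkinnerWan2017, §3.3.4 (arXiv:1512.06894 p. 13), "`0 → H¹_ac(K,W) → H¹_{ac^Σ}(K,W) → P_ac(W;Σ)`"] -/
theorem ker_locSel_eq (hSp : ∀ v ∈ S, ((p : ℕ) : 𝓞 K) ∉ v.asIdeal) :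
    (locSel E p 𝔭 hS).ker = (selmerAcBase E p 𝔭 ∅).addSubgroupOf (selmerAcBase E p 𝔭 S) := by
  ext c
  rw [AddMonoidHom.mem_ker, AddSubgroup.mem_addSubgroupOf, mem_selmerAcBase_empty_iff_of_subset hSp]
  constructor
  · intro h
    refine ⟨c.2, fun v hv ↦ ?_⟩
    have h' := congr_fun h ⟨v, hS.mem_toFinset.mpr hv⟩
    rwa [locSel_apply, Pi.zero_apply] at h'
  · rintro ⟨-, h⟩
    funext v
    rw [locSel_apply, Pi.zero_apply]
    exact h v (hS.mem_toFinset.mp v.2)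

omit [Fact p.Prime] in
/-- `#ker (loc_Σ|Sel^Σ) = #Sel_𝔭(K, E[p^∞])`. [folklore] -/
theorem natCard_ker_locSel (hSp : ∀ v ∈ S, ((p : ℕ) : 𝓞 K) ∉ v.asIdeal) :
    Nat.card (locSel E p 𝔭 hS).ker = Nat.card (selmerAcBase E p 𝔭 ∅) := by
  rw [ker_locSel_eq hSp]
  exact Nat.card_congr (AddSubgroup.addSubgroupOfEquivOfLe
    (selmerOver_mono (Set.empty_subset S) :
      selmerAcBase E p 𝔭 ∅ ≤ selmerAcBase E p 𝔭 S)).toEquiv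

end Loc

/-! ## `Sel_𝔭(K_∞, E[p^∞])^γ ≅ loc_Σ⁻¹(∏ ker r_w)` along `(s^Σ)⁻¹`, and the count -/

section Passage

variable {K : Type} [Field K] [NumberField K]
variable {E : WeierstrassCurve K} {p : ℕ} [Fact p.Prime] {κ : ZpExtension K p}
  {𝔭 : HeightOneSpectrum (𝓞 K)} {S : Set (HeightOneSpectrum (𝓞 K))} {hS : S.Finite}

/-- A class of `loc_Σ⁻¹(∏_{w∈Σ} ker r_w)` restricts into `Sel_𝔭(K_∞, E[p^∞])`
(`resOfLe_mem_selmerAc_empty_iff`). [cite: GreenbergLNM1716, §3 p. 90] -/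
theorem resOfLe_mem_selmerAc_empty_of_mem_comap (hSp : ∀ v ∈ S, ((p : ℕ) : 𝓞 K) ∉ v.asIdeal)
    {c : selmerAcBase E p 𝔭 S} (hc : c ∈ (localKerPi E p κ hS).comap (locSel E p 𝔭 hS)) :
    E.resOfLe p (le_top : κ.kerSubgroup ≤ ⊤) (c : E.subgroupH1 p ⊤) ∈ selmerAc E p κ 𝔭 ∅ := by
  refine (resOfLe_mem_selmerAc_empty_iff hSp c.2).mpr fun v hv ↦ ?_
  have h := (mem_localKerPi_iff _).mp (AddSubgroup.mem_comap.mp hc) ⟨v, hS.mem_toFinset.mpr hv⟩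
  rwa [locSel_apply] at h

/-- Conversely, a class of `Sel_𝔭^Σ(K, E[p^∞])` whose restriction lies in `Sel_𝔭(K_∞, E[p^∞])` belongs
to `loc_Σ⁻¹(∏_{w∈Σ} ker r_w)`. [cite: GreenbergLNM1716, §3 p. 90] -/
theorem mem_comap_of_resOfLe_mem_selmerAc_empty (hSp : ∀ v ∈ S, ((p : ℕ) : 𝓞 K) ∉ v.asIdeal)
    {c : selmerAcBase E p 𝔭 S}
    (hc : E.resOfLe p (le_top : κ.kerSubgroup ≤ ⊤) (c : E.subgroupH1 p ⊤) ∈ selmerAc E p κ 𝔭 ∅) :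
    c ∈ (localKerPi E p κ hS).comap (locSel E p 𝔭 hS) := by
  refine AddSubgroup.mem_comap.mpr ((mem_localKerPi_iff _).mpr fun v ↦ ?_)
  rw [locSel_apply]
  exact (resOfLe_mem_selmerAc_empty_iff hSp c.2).mp hc v (hS.mem_toFinset.mp v.2)

/-- A restricted class is fixed by `conj_γ`: `⟨res c, h⟩ ∈ Sel_𝔭(K_∞, E[p^∞])^γ` for every proof `h`
of membership (`conjH1_resOfLe_top`). [cite: GreenbergLNM1716, §3 p. 85 ("the image of `h_n` is contained in the `Γ_n`-invariants")] -/
theorem res_mk_mem_endInvariants_empty (γ : absoluteGaloisGroup K)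
    (c : E.subgroupH1 p (⊤ : Subgroup (absoluteGaloisGroup K)))
    (h : E.resOfLe p (le_top : κ.kerSubgroup ≤ ⊤) c ∈ selmerAc E p κ 𝔭 ∅) :
    (⟨E.resOfLe p (le_top : κ.kerSubgroup ≤ ⊤) c, h⟩ : selmerAc E p κ 𝔭 ∅) ∈
      IwasawaDual.endInvariants (conjSelmerAc E p κ 𝔭 ∅ γ - 1) := by
  rw [IwasawaDual.mem_endInvariants_iff, IwasawaDual.End_sub_apply, AddMonoid.End.one_apply,
    sub_eq_zero]
  exact Subtype.ext (conjH1_resOfLe_top γ c)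

/-- The map `loc_Σ⁻¹(∏_{w∈Σ} ker r_w) → Sel_𝔭(K_∞, E[p^∞])^γ`, `c ↦ res_{K→K_∞} c`.
[cite: GreenbergLNM1716, §3 pp. 85–86] [cite: JetchevSkinnerWan2017, §3.3.4 (arXiv:1512.06894 p. 13)] -/
def resToEndInvariantsEmpty (hSp : ∀ v ∈ S, ((p : ℕ) : 𝓞 K) ∉ v.asIdeal) (γ : absoluteGaloisGroup K)
    (c : (localKerPi E p κ hS).comap (locSel E p 𝔭 hS)) :
    IwasawaDual.endInvariants (conjSelmerAc E p κ 𝔭 ∅ γ - 1) :=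
  ⟨⟨E.resOfLe p (le_top : κ.kerSubgroup ≤ ⊤) ((c : selmerAcBase E p 𝔭 S) : E.subgroupH1 p ⊤),
      resOfLe_mem_selmerAc_empty_of_mem_comap hSp c.2⟩,
    res_mk_mem_endInvariants_empty γ _ _⟩

/-- Unfolding `resToEndInvariantsEmpty` on underlying classes. [folklore] -/
theorem coe_resToEndInvariantsEmpty (hSp : ∀ v ∈ S, ((p : ℕ) : 𝓞 K) ∉ v.asIdeal)
    (γ : absoluteGaloisGroup K) (c : (localKerPi E p κ hS).comap (locSel E p 𝔭 hS)) :
    (((resToEndInvariantsEmpty hSp γ c : IwasawaDual.endInvariants (conjSelmerAc E p κ 𝔭 ∅ γ - 1)) :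
        selmerAc E p κ 𝔭 ∅) : E.subgroupH1 p κ.kerSubgroup) =
      E.resOfLe p (le_top : κ.kerSubgroup ≤ ⊤) ((c : selmerAcBase E p 𝔭 S) : E.subgroupH1 p ⊤) :=
  rfl

/-- `c ↦ res c` on `loc_Σ⁻¹(∏ ker r_w)` is injective as soon as `s^Σ` is. [cite: GreenbergLNM1716, §3 Lemma 3.1 (p. 86)] -/
theorem resToEndInvariantsEmpty_injective (hSp : ∀ v ∈ S, ((p : ℕ) : 𝓞 K) ∉ v.asIdeal)
    (γ : absoluteGaloisGroup K) (hinj : Function.Injective (controlMap E p κ 𝔭 S γ)) :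
    Function.Injective (resToEndInvariantsEmpty (E := E) (κ := κ) (𝔭 := 𝔭) (hS := hS) hSp γ) := by
  intro c c' h
  have h1 : E.resOfLe p (le_top : κ.kerSubgroup ≤ ⊤) ((c : selmerAcBase E p 𝔭 S) : E.subgroupH1 p ⊤) =
      E.resOfLe p (le_top : κ.kerSubgroup ≤ ⊤) ((c' : selmerAcBase E p 𝔭 S) : E.subgroupH1 p ⊤) := by
    rw [← coe_resToEndInvariantsEmpty hSp γ c, ← coe_resToEndInvariantsEmpty hSp γ c', h]
  have h2 : controlMap E p κ 𝔭 S γ (c : selmerAcBase E p 𝔭 S) =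
      controlMap E p κ 𝔭 S γ (c' : selmerAcBase E p 𝔭 S) := by
    apply Subtype.ext
    apply Subtype.ext
    rw [coe_controlMap_apply, coe_controlMap_apply, h1]
  exact Subtype.ext (hinj h2)

/-- A `γ`-invariant class of `Sel_𝔭(K_∞, E[p^∞])` is a `γ`-invariant class of `Sel_𝔭^Σ(K_∞, E[p^∞])`
(`Sel_𝔭 ≤ Sel_𝔭^Σ`, `selmerAc_empty_le`). [cite: Castella2018, Def. 2.2 (arXiv:1704.06608 p. 5), "`Σ`-imprimitive"] -/
theorem inclusion_mem_endInvariants (γ : absoluteGaloisGroup K)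
    (x : IwasawaDual.endInvariants (conjSelmerAc E p κ 𝔭 ∅ γ - 1)) :
    (⟨((x : selmerAc E p κ 𝔭 ∅) : E.subgroupH1 p κ.kerSubgroup),
        selmerAc_empty_le (x : selmerAc E p κ 𝔭 ∅).2⟩ : selmerAc E p κ 𝔭 S) ∈
      IwasawaDual.endInvariants (conjSelmerAc E p κ 𝔭 S γ - 1) := by
  have hx := (IwasawaDual.mem_endInvariants_iff _ _).mp x.2
  rw [IwasawaDual.End_sub_apply, AddMonoid.End.one_apply, sub_eq_zero] at hx
  have hxfix : E.conjH1 p κ.kerSubgroup γ ((x : selmerAc E p κ 𝔭 ∅) : E.subgroupH1 p κ.kerSubgroup) =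
      ((x : selmerAc E p κ 𝔭 ∅) : E.subgroupH1 p κ.kerSubgroup) := by
    rw [← coe_conjSelmerAc_apply, hx]
  rw [IwasawaDual.mem_endInvariants_iff, IwasawaDual.End_sub_apply, AddMonoid.End.one_apply,
    sub_eq_zero]
  exact Subtype.ext hxfix

/-- `s^Σ c = ⟨⟨v, _⟩, _⟩` read on underlying classes: `res c = v`. (Stated with the class `v` as a
free variable ON PURPOSE: instantiating a general `y : Sel^γ` by an anonymous constructor makes the
kernel compare membership predicates for different `Σ` by unfolding — a deterministic timeout.)
[folklore] -/
theorem resOfLe_eq_of_controlMap_eq_mk (γ : absoluteGaloisGroup K) {c : selmerAcBase E p 𝔭 S}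
    {v : E.subgroupH1 p κ.kerSubgroup} {hv : v ∈ selmerAc E p κ 𝔭 S}
    {hv' : (⟨v, hv⟩ : selmerAc E p κ 𝔭 S) ∈ IwasawaDual.endInvariants (conjSelmerAc E p κ 𝔭 S γ - 1)}
    (h : controlMap E p κ 𝔭 S γ c = ⟨⟨v, hv⟩, hv'⟩) :
    E.resOfLe p (le_top : κ.kerSubgroup ≤ ⊤) (c : E.subgroupH1 p ⊤) = v := by
  rw [← coe_controlMap_apply γ c, h]

/-- Every `γ`-invariant class of `Sel_𝔭(K_∞, E[p^∞])` is the restriction of a class of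
`loc_Σ⁻¹(∏_{w∈Σ} ker r_w)` as soon as `s^Σ` is onto (it is `s^Σ c`, `c ∈ Sel_𝔭^Σ(K)`, and
`c ∈ loc_Σ⁻¹(∏ ker r_w)` by `resOfLe_mem_selmerAc_empty_iff`). [cite: GreenbergLNM1716, §3 Lemma 3.2 (p. 86) and p. 90] -/
theorem exists_mem_comap_resOfLe_eq (hSp : ∀ v ∈ S, ((p : ℕ) : 𝓞 K) ∉ v.asIdeal)
    (γ : absoluteGaloisGroup K) (hsurj : Function.Surjective (controlMap E p κ 𝔭 S γ))
    (x : IwasawaDual.endInvariants (conjSelmerAc E p κ 𝔭 ∅ γ - 1)) :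
    ∃ c : selmerAcBase E p 𝔭 S, c ∈ (localKerPi E p κ hS).comap (locSel E p 𝔭 hS) ∧
      E.resOfLe p (le_top : κ.kerSubgroup ≤ ⊤) (c : E.subgroupH1 p ⊤) =
        ((x : selmerAc E p κ 𝔭 ∅) : E.subgroupH1 p κ.kerSubgroup) := by
  obtain ⟨c, hc⟩ := hsurj ⟨⟨((x : selmerAc E p κ 𝔭 ∅) : E.subgroupH1 p κ.kerSubgroup),
    selmerAc_empty_le (x : selmerAc E p κ 𝔭 ∅).2⟩, inclusion_mem_endInvariants γ x⟩
  have hres := resOfLe_eq_of_controlMap_eq_mk γ hc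
  have hmem : E.resOfLe p (le_top : κ.kerSubgroup ≤ ⊤) (c : E.subgroupH1 p ⊤) ∈ selmerAc E p κ 𝔭 ∅ := by
    rw [hres]
    exact (x : selmerAc E p κ 𝔭 ∅).2
  exact ⟨c, mem_comap_of_resOfLe_mem_selmerAc_empty hSp hmem, hres⟩

/-- `c ↦ res c` on `loc_Σ⁻¹(∏ ker r_w)` is onto `Sel_𝔭(K_∞, E[p^∞])^γ` as soon as `s^Σ` is onto
`Sel_𝔭^Σ(K_∞, E[p^∞])^γ` (`exists_mem_comap_resOfLe_eq`). [cite: GreenbergLNM1716, §3 Lemma 3.2 (p. 86) and p. 90] -/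
theorem resToEndInvariantsEmpty_surjective (hSp : ∀ v ∈ S, ((p : ℕ) : 𝓞 K) ∉ v.asIdeal)
    (γ : absoluteGaloisGroup K) (hsurj : Function.Surjective (controlMap E p κ 𝔭 S γ)) :
    Function.Surjective (resToEndInvariantsEmpty (E := E) (κ := κ) (𝔭 := 𝔭) (hS := hS) hSp γ) := by
  intro x
  obtain ⟨c, hcA, hres⟩ := exists_mem_comap_resOfLe_eq (hS := hS) hSp γ hsurj x
  refine ⟨⟨c, hcA⟩, Subtype.ext (Subtype.ext ?_)⟩
  rw [coe_resToEndInvariantsEmpty]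
  exact hres

/-- **`(s^Σ)⁻¹` identifies `Sel_𝔭(K_∞, E[p^∞])^γ` with `loc_Σ⁻¹(∏_{w∈Σ} ker r_w) ⊆ Sel_𝔭^Σ(K, E[p^∞])`**
(`Σ` finite, away from `p`, `s^Σ` bijective). [cite: GreenbergLNM1716, §3 pp. 85–86 and p. 90] [cite: JetchevSkinnerWan2017, §3.3.4 (arXiv:1512.06894 p. 13)] -/
theorem resToEndInvariantsEmpty_bijective (hSp : ∀ v ∈ S, ((p : ℕ) : 𝓞 K) ∉ v.asIdeal)
    (γ : absoluteGaloisGroup K) (hbij : Function.Bijective (controlMap E p κ 𝔭 S γ)) :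
    Function.Bijective (resToEndInvariantsEmpty (E := E) (κ := κ) (𝔭 := 𝔭) (hS := hS) hSp γ) :=
  ⟨resToEndInvariantsEmpty_injective hSp γ hbij.1, resToEndInvariantsEmpty_surjective hSp γ hbij.2⟩

/-- **THE `Σ → ∅` PASSAGE, exact form.** For `E/K`, a `ℤ_p`-extension `κ`, `𝔭`, a finite `Σ` away
from `p` and `γ ∈ Γ_K` with `s^Σ : Sel_𝔭^Σ(K, E[p^∞]) → Sel_𝔭^Σ(K_∞, E[p^∞])^γ` bijective:
`#Sel_𝔭(K_∞, E[p^∞])^γ = #Sel_𝔭(K, E[p^∞]) · #(im loc_Σ ∩ ∏_{w∈Σ} ker r_w)` (`Nat.card`, no finiteness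
assumed). JSW17 §3.3.4: "`#H¹_{ac^Σ}(K,M)^Γ / #H¹_{ac^Σ}(K,W) = #coker(s)/#ker(s) = #ker(r)/#ker(h)`",
here between `Σ` and `∅` with the image of the localisation kept explicit (its surjectivity, loc.
cit. Prop. 3.3.2, is Poitou–Tate and NOT proved here).
[cite: JetchevSkinnerWan2017, §3.3.4 (arXiv:1512.06894 pp. 13–14)] [cite: GreenbergLNM1716, §3 pp. 85–90] -/
theorem natCard_endInvariants_empty_eq (hSp : ∀ v ∈ S, ((p : ℕ) : 𝓞 K) ∉ v.asIdeal)
    (γ : absoluteGaloisGroup K) (hbij : Function.Bijective (controlMap E p κ 𝔭 S γ)) :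
    Nat.card (IwasawaDual.endInvariants (conjSelmerAc E p κ 𝔭 ∅ γ - 1)) =
      Nat.card (selmerAcBase E p 𝔭 ∅) *
        Nat.card ↥((locSel E p 𝔭 hS).range ⊓ localKerPi E p κ hS) := by
  rw [← Nat.card_congr (Equiv.ofBijective _ (resToEndInvariantsEmpty_bijective hSp γ hbij)),
    natCard_comap_eq_natCard_ker_mul, natCard_ker_locSel hSp]

/-- **… and with the localisation ONTO `∏ ker r_w`** (e.g. JSW17 Prop. 3.3.2 (restrict-eq2), typed in
`AnticyclotomicControlAtoms.lean`): `#Sel_𝔭(K_∞, E[p^∞])^γ = #Sel_𝔭(K, E[p^∞]) · ∏_{w∈Σ} #ker r_w`.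
[cite: JetchevSkinnerWan2017, §3.3.4 (arXiv:1512.06894 pp. 13–14), (eq:selmin1)] [cite: GreenbergLNM1716, §3 Thm. 1.2 / p. 90] -/
theorem natCard_endInvariants_empty_eq_mul_prod (hSp : ∀ v ∈ S, ((p : ℕ) : 𝓞 K) ∉ v.asIdeal)
    (γ : absoluteGaloisGroup K) (hbij : Function.Bijective (controlMap E p κ 𝔭 S γ))
    (hloc : localKerPi E p κ hS ≤ (locSel E p 𝔭 hS).range) :
    Nat.card (IwasawaDual.endInvariants (conjSelmerAc E p κ 𝔭 ∅ γ - 1)) =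
      Nat.card (selmerAcBase E p 𝔭 ∅) *
        ∏ v ∈ hS.toFinset, Nat.card (localKer κ.kerSubgroup (E.geomPrimaryTorsion p) v) := by
  rw [natCard_endInvariants_empty_eq hSp γ hbij, inf_eq_right.mpr hloc, natCard_localKerPi]

end Passage

end Summit.BirchSwinnertonDyer.Rank1Residual.X11b.AcSelmer

end
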